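import Summits.NavierStokesRegularity.NavierStokesRegularity.Theorems.ScenarioCensusRowF1Columnar
import HarnessLib

/-!
# LINE «columnar-top» port, part 2/4: the singular Type-I zoom package with gradients; the line Liouville theorem in `𝒦_C`

Re-homed for the scenario census (typer seat ns-census-typer-1 g7; the cells F1sd ⊆ F1co and F1sv ⊆ F1vs ⊆ F1va are MEMBERS OF RECORD «DECIDED IN
KERNEL IN FILES» of row F1 since census v1.68 (critic idea-crit-3 PASS 19:19:37Z; ref ns-census-ref g8 PRE-CHECK ✓ §13.14 [2/6]; lit §21.20); this port makes
them TREE-decided): VERBATIM PORT of ns-idea-3 LINE 15 «columnar-top», `pub/ideators/ns-idea-3/lines/columnar-top/line-columnar-top.lean` sha16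
c9a7d5b1dc6ba717 (818 l., lean check rc 0, 0 sorry), split for the 400-line rule into `ScenarioCensusRowF1Columnar` (§1) → `…ColumnarZoom` (§2) →
`…ColumnarTransfer` (§3) → `…ColumnarTop` (§4 + census KEYS).  Lean text VERBATIM in namespace `…Theorems.ScenarioCensus.ColumnarTop` (the line's
`…Cruxes.ScenarioCensusRowF1.ColumnarTopLine` re-homed); port edits: `@[conjecture]` on the residual `ColumnarCollapse` (≡ `ScenarioCensus.Row_F1`, OPEN),
three one-line docstrings added.

No census VALUE is moved here (row F1 stays OPEN-WITH-LINE; the members become TREE-decided by name); NS regularity is NOT proved; `Row_F1` is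
untouched (zero movement, `columnarCollapse_iff_rowF1`); no summit statement is proved by this file.
-/

-- the summit and its single problem share the name `NavierStokesRegularity` (D-0017 nested layout)
set_option linter.dupNamespace false

noncomputable section

open MeasureTheory Set Function Filter TopologicalSpace Metric
open scoped Topology NNReal ENNReal InnerProductSpace RealInnerProductSpace

namespace Summit.NavierStokesRegularity.NavierStokesRegularity.Theorems.ScenarioCensus.ColumnarTop

open Literature.Analysis Literature.Analysis.FluidPDE
open Summit.NavierStokesRegularity.NavierStokesRegularity.Theorems

/-! ## §2 The singular Type-I zoom package with gradients; the line Liouville theorem in `𝒦_C` -/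

/-- **The singular Type-I zoom package, with gradients** at a backward-singular final-time point `(T, x₀)`
of a Type-I Clay solution: positive constants `α, β, R`, positive scales `c_j → 0` and a NONTRIVIAL element
`W ∈ 𝒦_C` such that the zooms `(c_j α) u(T + c_j² β t, x₀ + c_j R y)` converge to `W(t, y)` AND their
gradients `(c_j α)(c_j R) ∇u(T + c_j² β t, x₀ + c_j R y)` converge to `∇W(t, y)` at every point of the open
past (LINE 14's package plus the second conjunct of `exists_tendsto_of_typeI_seq_Ioo`, rescaled by
`fderiv_stPull`). (refs: AlbrittonBarker2019, §3; KochNadirashviliSereginSverak2009, Lemma 6.1) -/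
theorem exists_singularZoom_package {ν T : ℝ} (hν : 0 < ν) (hT : 0 < T)
    {u : ℝ → E3 → E3} {p : ℝ → E3 → ℝ}
    (hsol : IsClassicalNSSolutionOn (Ico 0 T) ν 0 u p) (hLH : IsLerayHopfOn T ν 0 (u 0) u)
    (hdec : HasRapidSpatialDecay (u 0)) (hTI : IsTypeIBlowup u T) (x₀ : E3)
    (hsing : ∀ r : ℝ, 0 < r →
      eLpNorm (uncurry u) ∞ (volume.restrict (parabolicCylinder r ((T : ℝ), x₀))) = ∞) :
    ∃ (C α β R : ℝ) (c : ℕ → ℝ) (W : ℝ → E3 → E3),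
      0 < α ∧ 0 < β ∧ 0 < R ∧ (∀ j, 0 < c j) ∧ Tendsto c atTop (𝓝 0) ∧ IsTypeIAncientMild C W ∧
      (∀ t < 0, ∀ y : E3,
        Tendsto (fun j => (c j * α) • u (T + c j ^ 2 * β * t) (x₀ + (c j * R) • y)) atTop (𝓝 (W t y))) ∧
      (∀ t < 0, ∀ y : E3,
        Tendsto (fun j => (c j * α * (c j * R)) • fderiv ℝ (u (T + c j ^ 2 * β * t)) (x₀ + (c j * R) • y))
          atTop (𝓝 (fderiv ℝ (W t) y))) ∧
      ∃ t < 0, ∃ y, W t y ≠ 0 := by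
  -- ## (1) the Type-I rate window, the Morrey bound and the unit zoom at `(T, x₀)`
  obtain ⟨C, δ, -, hδ, hδT, hrate⟩ := exists_typeI_rate_window hT hTI
  obtain ⟨r₀, M₀, T₁, hr₀, hT₁, hMor⟩ := morrey_of_typeI hν hT hsol hLH hTI
  obtain ⟨R, α, β, hR, hα, hβ, hβeq, hαeq, hβT, hball, hGv, htypeI⟩ :=
    exists_zoom_typeIBound_lt_top_of_morrey hν hT hsol hLH hr₀ hT₁ hMor x₀
  set v : ℝ → E3 → E3 := α • stPull β R T x₀ u with hv
  set πv : ℝ → E3 → ℝ :=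
    α ^ 2 • stPull β R T x₀ (fun t x => p t x - (p t 0 - normalisedPressure (u t) 0)) with hπv
  set Gv : ℝ → E3 → E3 →L[ℝ] E3 :=
    (α * R) • stPull β R T x₀ (fun t x => fderiv ℝ (u t) x) with hGvdef
  set I₀ : ℝ≥0∞ := typeIBound (parabolicCylinder (1 / 2) (0 : ℝ × E3)) v πv Gv with hI₀
  have hI₀top : I₀ ≠ ⊤ := htypeI.ne
  -- ## (2) the scales `c k = 1/(k+4) ↓ 0` and the zoom sequence
  set c : ℕ → ℝ := fun k => 1 / ((k : ℝ) + 4) with hc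
  have hcpos : ∀ k, 0 < c k := fun k => by simp only [hc]; positivity
  have hc4 : ∀ k, c k ≤ 1 / 4 := fun k =>
    div_le_div_of_nonneg_left zero_le_one (by norm_num) (by linarith [(Nat.cast_nonneg k : (0 : ℝ) ≤ k)])
  have hc2 : ∀ k, c k ≤ 1 / 2 := fun k => (hc4 k).trans (by norm_num)
  have hclim : Tendsto c atTop (𝓝 0) :=
    tendsto_const_nhds.div_atTop (tendsto_atTop_add_const_right _ _ tendsto_natCast_atTop_atTop)
  set w : ℕ → ℝ → E3 → E3 :=
    fun k => (c k * α) • stPull (c k ^ 2 * β) (c k * R) T x₀ u with hw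
  -- the final windows `(Aw k, 0)`, `Aw k → -∞`
  set Aw : ℕ → ℝ := fun k => -(δ / (c k ^ 2 * β)) with hA
  have hAk : ∀ k, Aw k = -(δ / β * ((k : ℝ) + 4) ^ 2) := by
    intro k
    simp only [hA, hc]
    field_simp
  have hAlim : Tendsto Aw atTop atBot := by
    have h1 : Tendsto (fun k : ℕ => ((k : ℝ) + 4) ^ 2) atTop atTop :=
      (tendsto_pow_atTop two_ne_zero).comp
        (tendsto_atTop_add_const_right _ _ tendsto_natCast_atTop_atTop)
    have h2 : Tendsto (fun k : ℕ => δ / β * ((k : ℝ) + 4) ^ 2) atTop atTop :=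
      h1.const_mul_atTop (by positivity)
    refine (tendsto_neg_atTop_atBot.comp h2).congr fun k => ?_
    rw [hAk k]
    rfl
  -- ## (3) per-scale facts
  have hcW : ∀ k, ContinuousOn (uncurry (w k)) (Ioo (Aw k) 0 ×ˢ univ) := fun k =>
    zoom_continuousOn hν hsol hR hαeq hβeq (hcpos k) hδT
  have hdivW : ∀ k, ∀ t ∈ Ioo (Aw k) 0, IsWeaklyDivFree (w k t) := fun k t ht =>
    zoom_isWeaklyDivFree hν hsol hR hαeq hβeq (hcpos k) hδT ht
  have hmildW : ∀ k, ∀ s t : ℝ, Aw k < s → s < t → t < 0 → ∀ y,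
      w k t y = UnboundedOperators.heatExtension (w k s) (t - s) y -
        oseenDuhamel 1 s (w k) (w k) t y := fun k s t hs hst ht y =>
    zoom_oseen hν hT hsol hLH hdec hR hαeq hβeq (hcpos k) hδT hs hst ht y
  set C₁ : ℝ := α * C / Real.sqrt β with hC₁
  have hIW : ∀ k, ∀ t ∈ Ioo (Aw k) 0, ∀ y, ‖w k t y‖ ≤ C₁ / Real.sqrt (-t) := fun k t ht y =>
    zoom_norm_le hR hαeq hβeq hν (hcpos k) hδT hrate ht y
  -- ## (4) extraction of the `C¹_loc` limit `W ∈ 𝒦_{C₁}` (values AND gradients converge pointwise)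
  obtain ⟨φ, hφ, W, hWclass, hpt, hgrad, -, -⟩ :=
    exists_tendsto_of_typeI_seq_Ioo C₁ hAlim hcW hdivW hmildW hIW
  have hφt : Tendsto φ atTop atTop := hφ.tendsto_atTop
  have hcφ : Tendsto (fun j => c (φ j)) atTop (𝓝 0) := hclim.comp hφt
  -- ## (6) `W` is unbounded at the origin
  have hsingW : ∀ r > 0, ∀ M : ℝ, ∃ t ∈ Ioo (-(r ^ 2)) (0 : ℝ),
      ∃ x ∈ ball (0 : E3) r, M < ‖W t x‖ :=
    zoomSeq_unbounded_at_origin (πv := πv) hsol hR hα hβ hβT hsing hball hGv hI₀top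
      (fun j => hcpos (φ j)) (fun j => hc2 (φ j)) fun z hz =>
        hpt z.1 ((SuitableCompactness.mem_parabolicCylinder_zero.1 hz).1.2) z.2
  have hwu : ∀ (j : ℕ) (t : ℝ) (y : E3),
      w (φ j) t y = (c (φ j) * α) • u (T + c (φ j) ^ 2 * β * t) (x₀ + (c (φ j) * R) • y) :=
    fun j t y => by simp only [hw, smul_stPull_apply]
  have hwD : ∀ (j : ℕ) (t : ℝ) (y : E3),
      fderiv ℝ (w (φ j) t) y = (c (φ j) * α * (c (φ j) * R)) •
        fderiv ℝ (u (T + c (φ j) ^ 2 * β * t)) (x₀ + (c (φ j) * R) • y) := by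
    intro j t y
    have e1 : w (φ j) t = (c (φ j) * α) • stPull (c (φ j) ^ 2 * β) (c (φ j) * R) T x₀ u t := by
      simp only [hw, Pi.smul_apply]
    rw [e1, fderiv_const_smul_field, Pi.smul_apply, fderiv_stPull, smul_smul]
  -- ## (7) package
  obtain ⟨ts, hts, xs, -, hM⟩ := hsingW 1 one_pos 0
  have hne : W ts xs ≠ 0 := by
    intro h0; rw [h0, norm_zero] at hM; exact lt_irrefl _ hM
  exact ⟨C₁, α, β, R, fun j => c (φ j), W, hα, hβ, hR, fun j => hcpos _, hcφ, hWclass,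
    fun t ht y => (hpt t ht y).congr fun j => hwu j t y,
    fun t ht y => (hgrad t ht y).congr fun j => hwD j t y, ts, hts.2, xs, hne⟩

/-- A linear isometry of `ℝ³` taking the coordinate vector `e₁` (Lean index `1`) to a given unit vector
(Householder reflection; copy of the private tree lemma in `BarkerPrange2020VorticityAlignmentTypeIHolds`). -/
theorem exists_linearIsometryEquiv_map_single_one {a : E3} (ha : ‖a‖ = 1) :
    ∃ Rot : E3 ≃ₗᵢ[ℝ] E3, Rot (EuclideanSpace.single (1 : Fin 3) (1 : ℝ)) = a := by
  have h1 : ‖(EuclideanSpace.single (1 : Fin 3) (1 : ℝ) : E3)‖ = ‖a‖ := by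
    rw [ha]
    simp
  exact ⟨_, Submodule.reflection_sub h1⟩

/-- **Line Liouville theorem in `𝒦_C`** (KNSS 2009 Thm 5.1 in the tree's rate form, after a rotation and a
time shift; the argument is Step E of the tree's
`not_isBackwardSingularPoint_of_typeIAncientMild_of_curl_parallel_slice`): an element of `𝒦_C` all of whose
slices are invariant under translations along a fixed nonzero vector vanishes identically.
(refs: KochNadirashviliSereginSverak2009, Thm 5.1 (arXiv:0709.3599 p. 9); BarkerPrange2020Alignment, Remark 5) -/
theorem eq_zero_of_lineInvariant {C : ℝ} {W : ℝ → E3 → E3} (hW : IsTypeIAncientMild C W)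
    {e : E3} (he : e ≠ 0) (hinv : ∀ t < (0 : ℝ), ∀ y (r : ℝ), W t (y + r • e) = W t y) :
    ∀ t < (0 : ℝ), ∀ x, W t x = 0 := by
  have hC : 0 ≤ C := hW.nonneg
  set a : E3 := ‖e‖⁻¹ • e with ha
  have ha1 : ‖a‖ = 1 := by
    rw [ha, norm_smul, norm_inv, norm_norm, inv_mul_cancel₀ (norm_ne_zero_iff.2 he)]
  obtain ⟨Rot, hRot⟩ := exists_linearIsometryEquiv_map_single_one ha1
  have hzero : ∀ δ : ℝ, 0 < δ → ∀ t < (0 : ℝ), ∀ x, W (t - δ) x = 0 := by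
    intro δ hδ
    have hV := hW.comp_sub_right hδ.le
    set V : ℝ → E3 → E3 := fun t y => Rot.symm (W (t - δ) (Rot y)) with hVdef
    have hVc : ContinuousOn (uncurry V) (Iio 0 ×ˢ univ) := by
      have e1 : uncurry V = Rot.symm ∘ uncurry (fun t => W (t - δ)) ∘
          fun q : ℝ × E3 => (q.1, Rot q.2) := by
        funext q
        rfl
      rw [e1]
      refine Rot.symm.continuous.comp_continuousOn (hV.continuousOn_uncurry.comp
        (continuous_fst.prodMk (Rot.continuous.comp continuous_snd)).continuousOn ?_)
      intro q hq
      exact ⟨hq.1, mem_univ _⟩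
    obtain ⟨K, hK⟩ := hW.isBoundedOn hδ
    have hVbd : ∃ K : ℝ, ∀ t < 0, ∀ x, ‖V t x‖ ≤ K :=
      ⟨K, fun t ht x => by
        show ‖Rot.symm (W (t - δ) (Rot x))‖ ≤ K
        rw [LinearIsometryEquiv.norm_map]
        exact hK (t - δ) (by simp only [mem_Iio]; linarith) (Rot x)⟩
    have hVdiv : ∀ t < 0, IsWeaklyDivFree (V t) := by
      intro t ht
      have h1 := (hV.isWeaklyDivFree ht).conj_linearIsometryEquiv Rot.symm
      simpa only [LinearIsometryEquiv.symm_symm] using h1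
    have hVmild : ∀ s t : ℝ, s < t → t < 0 → ∀ x,
        V t x = UnboundedOperators.heatExtension (V s) (t - s) x - oseenDuhamel 1 s V V t x := by
      intro s t hst ht x
      have key := hV.mild_eq_heatExtension hst ht (Rot x)
      show Rot.symm (W (t - δ) (Rot x)) = _
      have key' : W (t - δ) (Rot x) =
          UnboundedOperators.heatExtension (fun y => W (s - δ) y) (t - s) (Rot x) -
          oseenDuhamel 1 s (fun τ => W (τ - δ)) (fun τ => W (τ - δ)) t (Rot x) := key
      rw [key', map_sub]
      congr 1
      · have h2 := heatExtension_conj_linearIsometryEquiv Rot.symm (fun y => W (s - δ) y) (t - s) x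
        simp only [LinearIsometryEquiv.symm_symm] at h2
        exact h2.symm
      · exact (oseenDuhamel_symm_conj_linearIsometryEquiv Rot 1 s (fun τ => W (τ - δ))
          (fun τ => W (τ - δ)) t x).symm
    have hVinv : ∀ t < 0, ∀ (x : E3) (d : ℝ), V t (x + EuclideanSpace.single 1 d) = V t x := by
      intro t ht x d
      show Rot.symm (W (t - δ) (Rot (x + EuclideanSpace.single 1 d))) = Rot.symm (W (t - δ) (Rot x))
      have hsingle : (EuclideanSpace.single (1 : Fin 3) d : E3) =
          d • EuclideanSpace.single (1 : Fin 3) (1 : ℝ) := by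
        ext j
        simp
      rw [map_add, hsingle, map_smul, hRot, ha, smul_smul, hinv (t - δ) (by linarith) (Rot x) (d * ‖e‖⁻¹)]
    have hVrate : ∀ t < 0, ∀ x, Real.sqrt (-t) * ‖V t x‖ ≤ C := by
      intro t ht x
      show Real.sqrt (-t) * ‖Rot.symm (W (t - δ) (Rot x))‖ ≤ C
      rw [LinearIsometryEquiv.norm_map]
      have h1 := hW.norm_le (by linarith : t - δ < 0) (Rot x)
      have hs1 : 0 < Real.sqrt (-(t - δ)) := Real.sqrt_pos.2 (by linarith)
      have hs2 : Real.sqrt (-t) ≤ Real.sqrt (-(t - δ)) := Real.sqrt_le_sqrt (by linarith)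
      have hq : 0 ≤ C / Real.sqrt (-(t - δ)) := div_nonneg hC hs1.le
      calc Real.sqrt (-t) * ‖W (t - δ) (Rot x)‖
          ≤ Real.sqrt (-t) * (C / Real.sqrt (-(t - δ))) := by gcongr
        _ ≤ Real.sqrt (-(t - δ)) * (C / Real.sqrt (-(t - δ))) := by gcongr
        _ = C := by field_simp
    have hV0 := KNSS2009_typeI_rate_liouville_holds hVc hVbd hVdiv hVmild hVinv hVrate
    intro t ht x
    have h1 := hV0 t ht (Rot.symm x)
    have h1' : Rot.symm (W (t - δ) (Rot (Rot.symm x))) = 0 := h1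
    rw [LinearIsometryEquiv.apply_symm_apply] at h1'
    exact Rot.symm.injective (by rw [h1', map_zero])
  intro t ht x
  have h := hzero (-t / 2) (by linarith) (t / 2) (by linarith) x
  rwa [show t / 2 - -t / 2 = t by ring] at h

end Summit.NavierStokesRegularity.NavierStokesRegularity.Theorems.ScenarioCensus.ColumnarTop

end
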